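import Literature.Analysis.FluidPDE.SawtoothCascade
import Mathlib.Analysis.Calculus.Deriv.MeanValue

/-!
# K2 lane (route-2 `SawtoothPulseCascade`, crux dir `K1LocalisedCascade`): the sawtooth Kelvin–Helmholtz rate in CLOSED FORM

Helper file of the K2 lane (phase budget lemma S1 of planner p4's line `bellman-weight`, memo
`Cruxes/K1LocalisedCascade/K2ControlNorm.md`; stmt-AnomalousDissipation-19491 is the seat's ACL item).

For `k > 0` write `x = πk`, `c = cos πβ`, `C = cosh x`, `s = sinh x` and `D(x) = 2 sinh x / x − cosh x`. From the tree's product form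
`sawC2_eq_sawC2prod` the two Rayleigh factors are `π/2 − s/(k(C−c)) = −(π/(2(C−c)))·(c + D)` and `π/2 − s/(k(C+c)) = (π/(2(C+c)))·(c − D)`,
whence the closed form

  `σ(k,β)² = max 0 ( (πk)²/4 · (cos²πβ − D(πk)²) / (cosh²πk − cos²πβ) )`   (`sawSigma_sq_eq`),

so the triangle-wave shear is Kelvin–Helmholtz unstable at `(k, β)` iff `|cos πβ| > |D(πk)|` (`sawSigma_eq_zero_of_cos_sq_le`,
`sq_lt_cos_sq_of_sawSigma_pos`), with the cell-friendly upper bound `sawSigma_sq_le_of_cos_sq_le`. The auxiliary function `D` is strictly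
monotone: `(x²+2) sinh x − 2x cosh x` has derivative `x² cosh x ≥ 0` (`khAux_nonneg`), and `D' = −((x²+2) sinh x − 2x cosh x)/x²`, so `D` is
antitone on `(0, ∞)` (`khD_antitoneOn`). Finally the DIAGONAL CUT-OFF `cos x ≤ D(x)` on `(0, π/2]` (`cos_le_khD`, from Mathlib's `|·| ≤ 1` Taylor
bounds at `x/2`) gives `σ(k, β) = 0` whenever `0 < k ≤ β ≤ ½` (`sawSigma_eq_zero_of_le`): a lattice class is never unstable on an unwrapped line
in both slots. No definitions (the function `D` is written out); no statement about the crux.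
[cite: Drazin2002, §8.3 (8.36)–(8.38) and Exercise 8.10 (Rayleigh jump conditions / product-form eigenvalue relation of broken-line profiles)] [problem: turb]
-/

-- `Summit.<Summit>.<Problem>`: single-conjunct summit, the duplicate namespace segment is deliberate.
set_option linter.dupNamespace false

noncomputable section

namespace Summit.AnomalousDissipation.AnomalousDissipation.Theorems.SawtoothPulseCascade.K2PhaseBudget

open Set Real Literature.Analysis.FluidPDE.SawtoothCascade

/-! ## §1 The closed form -/

/-- Algebra of the product form: for `k ≠ 0`, `k²·(−c²(k,β)) = (πk)²/4 · (cos²πβ − D(πk)²)/(cosh²πk − cos²πβ)` with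
`D(x) = 2 sinh x/x − cosh x`. [cite: Drazin2002, §8.3 (8.36)–(8.38) and Exercise 8.10] -/
theorem sq_mul_neg_sawC2_eq {k : ℝ} (hk : k ≠ 0) (β : ℝ) :
    k ^ 2 * (-(sawC2 k β)) =
      (π * k) ^ 2 / 4 * ((Real.cos (π * β)) ^ 2 - (2 * Real.sinh (π * k) / (π * k) - Real.cosh (π * k)) ^ 2) /
        ((Real.cosh (π * k)) ^ 2 - (Real.cos (π * β)) ^ 2) := by
  rw [sawC2_eq_sawC2prod hk]
  unfold sawC2prod
  have hx : π * k ≠ 0 := mul_ne_zero Real.pi_ne_zero hk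
  set s := Real.sinh (π * k) with hs
  set C := Real.cosh (π * k) with hC
  set c := Real.cos (π * β) with hc
  have hC1 : 1 < C := Real.one_lt_cosh.2 hx
  have hcle : c ≤ 1 := Real.cos_le_one _
  have hcge : -1 ≤ c := Real.neg_one_le_cos _
  have h1 : C - c ≠ 0 := by
    have : 0 < C - c := by linarith
    exact this.ne'
  have h2 : C + c ≠ 0 := by
    have : 0 < C + c := by linarith
    exact this.ne'
  have h3 : C ^ 2 - c ^ 2 ≠ 0 := by
    have : C ^ 2 - c ^ 2 = (C - c) * (C + c) := by ring
    rw [this]; exact mul_ne_zero h1 h2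
  field_simp
  ring

/-- **Closed form of the sawtooth Kelvin–Helmholtz rate.** For `k > 0`:
`σ(k,β)² = max 0 ((πk)²/4 · (cos²πβ − D(πk)²)/(cosh²πk − cos²πβ))`, `D(x) = 2 sinh x/x − cosh x`.
[cite: Drazin2002, §8.3 (8.36)–(8.38) and Exercise 8.10] -/
theorem sawSigma_sq_eq {k : ℝ} (hk : 0 < k) (β : ℝ) :
    sawSigma k β ^ 2 =
      max 0 ((π * k) ^ 2 / 4 * ((Real.cos (π * β)) ^ 2 - (2 * Real.sinh (π * k) / (π * k) - Real.cosh (π * k)) ^ 2) /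
        ((Real.cosh (π * k)) ^ 2 - (Real.cos (π * β)) ^ 2)) := by
  unfold sawSigma
  rw [mul_pow, Real.sq_sqrt (le_max_left _ _), mul_max_of_nonneg _ _ (sq_nonneg k), mul_zero,
    sq_mul_neg_sawC2_eq hk.ne' β]

/-- Positivity of the denominator `cosh²πk − cos²πβ` for `k ≠ 0`. [folklore] -/
theorem cosh_sq_sub_cos_sq_pos {k : ℝ} (hk : k ≠ 0) (β : ℝ) :
    0 < (Real.cosh (π * k)) ^ 2 - (Real.cos (π * β)) ^ 2 := by
  have hx : π * k ≠ 0 := mul_ne_zero Real.pi_ne_zero hk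
  have hC1 : 1 < Real.cosh (π * k) := Real.one_lt_cosh.2 hx
  have hc : (Real.cos (π * β)) ^ 2 ≤ 1 := by
    rw [sq_le_one_iff_abs_le_one]; exact Real.abs_cos_le_one _
  nlinarith

/-- **Instability criterion (stable side).** For `k > 0`: if `cos²πβ ≤ D(πk)²` then `σ(k,β) = 0`.
[cite: Drazin2002, §8.3 (8.36)–(8.38) and Exercise 8.10] -/
theorem sawSigma_eq_zero_of_cos_sq_le {k β : ℝ} (hk : 0 < k)
    (h : (Real.cos (π * β)) ^ 2 ≤ (2 * Real.sinh (π * k) / (π * k) - Real.cosh (π * k)) ^ 2) :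
    sawSigma k β = 0 := by
  have hden := cosh_sq_sub_cos_sq_pos hk.ne' β
  have hsq : sawSigma k β ^ 2 = 0 := by
    rw [sawSigma_sq_eq hk β, max_eq_left]
    apply div_nonpos_of_nonpos_of_nonneg _ hden.le
    exact mul_nonpos_of_nonneg_of_nonpos (by positivity) (by linarith)
  exact pow_eq_zero_iff (n := 2) (by norm_num) |>.1 hsq

/-- **Instability criterion (unstable side).** For `k > 0`: if `σ(k,β) > 0` then `D(πk)² < cos²πβ`.
[cite: Drazin2002, §8.3 (8.36)–(8.38) and Exercise 8.10] -/
theorem sq_lt_cos_sq_of_sawSigma_pos {k β : ℝ} (hk : 0 < k) (h : 0 < sawSigma k β) :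
    (2 * Real.sinh (π * k) / (π * k) - Real.cosh (π * k)) ^ 2 < (Real.cos (π * β)) ^ 2 := by
  by_contra hle
  have := sawSigma_eq_zero_of_cos_sq_le hk (not_lt.1 hle)
  linarith

/-- `σ ≥ 0` for `k ≥ 0`. [folklore] -/
theorem sawSigma_nonneg {k : ℝ} (hk : 0 ≤ k) (β : ℝ) : 0 ≤ sawSigma k β :=
  mul_nonneg hk (Real.sqrt_nonneg _)

/-- **Cell bound.** For `k > 0` and `cos²πβ ≤ q < cosh²πk`:
`σ(k,β)² ≤ (πk)²/4 · max 0 (cos²πβ − D(πk)²) / (cosh²πk − q)`. [folklore] -/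
theorem sawSigma_sq_le_of_cos_sq_le {k β q : ℝ} (hk : 0 < k) (hq : (Real.cos (π * β)) ^ 2 ≤ q)
    (hqC : q < (Real.cosh (π * k)) ^ 2) :
    sawSigma k β ^ 2 ≤
      (π * k) ^ 2 / 4 * max 0 ((Real.cos (π * β)) ^ 2 - (2 * Real.sinh (π * k) / (π * k) - Real.cosh (π * k)) ^ 2) /
        ((Real.cosh (π * k)) ^ 2 - q) := by
  rw [sawSigma_sq_eq hk β]
  have hden := cosh_sq_sub_cos_sq_pos hk.ne' β
  have hden' : 0 < (Real.cosh (π * k)) ^ 2 - q := by linarith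
  set N := (Real.cos (π * β)) ^ 2 - (2 * Real.sinh (π * k) / (π * k) - Real.cosh (π * k)) ^ 2 with hN
  have hA : 0 ≤ (π * k) ^ 2 / 4 := by positivity
  apply max_le
  · positivity
  · rcases le_or_gt N 0 with hN0 | hN0
    · have : (π * k) ^ 2 / 4 * N / ((Real.cosh (π * k)) ^ 2 - (Real.cos (π * β)) ^ 2) ≤ 0 :=
        div_nonpos_of_nonpos_of_nonneg (mul_nonpos_of_nonneg_of_nonpos hA hN0) hden.le
      exact this.trans (by positivity)
    · rw [max_eq_right hN0.le]
      rw [div_le_div_iff₀ hden hden']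
      have h1 : (Real.cosh (π * k)) ^ 2 - q ≤ (Real.cosh (π * k)) ^ 2 - (Real.cos (π * β)) ^ 2 := by linarith
      have h2 : 0 ≤ (π * k) ^ 2 / 4 * N := mul_nonneg hA hN0.le
      exact mul_le_mul_of_nonneg_left h1 h2

/-! ## §2 The auxiliary function `D(x) = 2 sinh x / x − cosh x` is antitone on `(0, ∞)` -/

/-- `(x² + 2) sinh x − 2x cosh x` has derivative `x² cosh x`. [folklore] -/
theorem hasDerivAt_khAux (x : ℝ) :
    HasDerivAt (fun x => (x ^ 2 + 2) * Real.sinh x - 2 * x * Real.cosh x) (x ^ 2 * Real.cosh x) x := by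
  have h1 : HasDerivAt (fun x : ℝ => x ^ 2 + 2) (2 * x) x := by
    simpa using (hasDerivAt_pow 2 x).add_const 2
  have h2 := Real.hasDerivAt_sinh x
  have h3 : HasDerivAt (fun x : ℝ => 2 * x) 2 x := by simpa using (hasDerivAt_id x).const_mul 2
  have h4 := Real.hasDerivAt_cosh x
  have h := (h1.fun_mul h2).fun_sub (h3.fun_mul h4)
  have e : 2 * x * Real.sinh x + (x ^ 2 + 2) * Real.cosh x - (2 * Real.cosh x + 2 * x * Real.sinh x) =
      x ^ 2 * Real.cosh x := by ring
  rw [e] at h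
  exact h

/-- `0 ≤ (x² + 2) sinh x − 2x cosh x` for `x ≥ 0` (monotone from `0`). [folklore] -/
theorem khAux_nonneg {x : ℝ} (hx : 0 ≤ x) : 0 ≤ (x ^ 2 + 2) * Real.sinh x - 2 * x * Real.cosh x := by
  have hmono : Monotone (fun x : ℝ => (x ^ 2 + 2) * Real.sinh x - 2 * x * Real.cosh x) :=
    monotone_of_hasDerivAt_nonneg (f' := fun x => x ^ 2 * Real.cosh x) hasDerivAt_khAux
      (fun x => by positivity)
  have h0 : (fun x : ℝ => (x ^ 2 + 2) * Real.sinh x - 2 * x * Real.cosh x) 0 = 0 := by simp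
  have := hmono hx
  simpa [h0] using this

/-- Derivative of `D(x) = 2 sinh x/x − cosh x` at `x ≠ 0`: `−((x²+2) sinh x − 2x cosh x)/x²`. [folklore] -/
theorem hasDerivAt_khD {x : ℝ} (hx : x ≠ 0) :
    HasDerivAt (fun x => 2 * Real.sinh x / x - Real.cosh x)
      (-(((x ^ 2 + 2) * Real.sinh x - 2 * x * Real.cosh x) / x ^ 2)) x := by
  have h1 : HasDerivAt (fun x => 2 * Real.sinh x) (2 * Real.cosh x) x := by
    simpa using (Real.hasDerivAt_sinh x).const_mul 2
  have h2 := (h1.fun_div (hasDerivAt_id x) hx).fun_sub (Real.hasDerivAt_cosh x)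
  have e : (2 * Real.cosh x * id x - 2 * Real.sinh x * 1) / id x ^ 2 - Real.sinh x =
      -(((x ^ 2 + 2) * Real.sinh x - 2 * x * Real.cosh x) / x ^ 2) := by
    simp only [id]
    field_simp
    ring
  rw [e] at h2
  exact h2

/-- **`D` is antitone on `(0, ∞)`.** [folklore] -/
theorem khD_antitoneOn : AntitoneOn (fun x : ℝ => 2 * Real.sinh x / x - Real.cosh x) (Ioi 0) := by
  have hconv : Convex ℝ (Ioi (0 : ℝ)) := convex_Ioi 0
  have hint : interior (Ioi (0 : ℝ)) = Ioi 0 := interior_Ioi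
  apply antitoneOn_of_hasDerivWithinAt_nonpos hconv
    (f' := fun x => -(((x ^ 2 + 2) * Real.sinh x - 2 * x * Real.cosh x) / x ^ 2))
  · intro x hx
    exact (hasDerivAt_khD (ne_of_gt hx)).continuousAt.continuousWithinAt
  · intro x hx
    rw [hint] at hx
    exact (hasDerivAt_khD (ne_of_gt hx)).hasDerivWithinAt
  · intro x hx
    rw [hint] at hx
    have hx0 : 0 < x := hx
    have := khAux_nonneg hx0.le
    have : 0 ≤ ((x ^ 2 + 2) * Real.sinh x - 2 * x * Real.cosh x) / x ^ 2 := by positivity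
    linarith

/-- Convenience: for `0 < x ≤ y`, `D y ≤ D x`. [folklore] -/
theorem khD_le_khD {x y : ℝ} (hx : 0 < x) (hxy : x ≤ y) :
    2 * Real.sinh y / y - Real.cosh y ≤ 2 * Real.sinh x / x - Real.cosh x :=
  khD_antitoneOn hx (lt_of_lt_of_le hx hxy) hxy

/-! ## §3 The diagonal cut-off `cos x ≤ D(x)` on `(0, π/2]` -/

/-- **Diagonal cut-off.** `cos x ≤ D(x) = 2 sinh x / x − cosh x` for `0 < x ≤ π/2` (indeed `D − cos = x²/3 − x⁴/15 + …`).
Proof: half-argument `x = 2y`, `|y| ≤ 1` Taylor bounds (`Real.sin_bound`-type lemma `sin_ge_sub_cube`, `Real.exp_bound`). [folklore] -/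
theorem cos_le_khD {x : ℝ} (hx0 : 0 < x) (hx1 : x ≤ π / 2) :
    Real.cos x ≤ 2 * Real.sinh x / x - Real.cosh x := by
  -- reduce to `x cos x + x cosh x ≤ 2 sinh x`
  rw [le_sub_iff_add_le, le_div_iff₀ hx0]
  set y := x / 2 with hy
  have hx2 : x = 2 * y := by rw [hy]; ring
  have hy0 : 0 < y := by rw [hy]; positivity
  have hyb : y ≤ 0.7854 := by
    have := Real.pi_lt_d6
    rw [hy]; linarith
  have hy1 : y ≤ 1 := by linarith
  -- two-sided order-5 Taylor control of `sinh y`, `cosh y` (`Real.exp_bound` at `±y`; cf. the tree's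
  -- `Literature.ComputerArithmetic.DeDinechinLauterMullerTorres2013.sinh_cosh_bounds`, not imported to keep this file light)
  obtain ⟨hS1, hS2, hC1, hC2⟩ :
      y + y ^ 3 / 6 - y ^ 5 / 100 ≤ Real.sinh y ∧ Real.sinh y ≤ y + y ^ 3 / 6 + y ^ 5 / 100 ∧
        1 + y ^ 2 / 2 + y ^ 4 / 24 - y ^ 5 / 100 ≤ Real.cosh y ∧
          Real.cosh y ≤ 1 + y ^ 2 / 2 + y ^ 4 / 24 + y ^ 5 / 100 := by
    have hay : |y| ≤ 1 := by rw [abs_of_nonneg hy0.le]; exact hy1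
    have hay' : |(-y)| ≤ 1 := by rw [abs_neg]; exact hay
    have h1 := Real.exp_bound hay (n := 5) (by norm_num)
    have h2 := Real.exp_bound hay' (n := 5) (by norm_num)
    rw [abs_of_nonneg hy0.le] at h1
    rw [abs_neg, abs_of_nonneg hy0.le] at h2
    have e1 : ∑ m ∈ Finset.range 5, y ^ m / (m.factorial : ℝ) = 1 + y + y ^ 2 / 2 + y ^ 3 / 6 + y ^ 4 / 24 := by
      simp only [Finset.sum_range_succ, Finset.sum_range_zero, Nat.factorial]
      push_cast
      ring
    have e2 : ∑ m ∈ Finset.range 5, (-y) ^ m / (m.factorial : ℝ) = 1 - y + y ^ 2 / 2 - y ^ 3 / 6 + y ^ 4 / 24 := by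
      simp only [Finset.sum_range_succ, Finset.sum_range_zero, Nat.factorial]
      push_cast
      ring
    have e3 : ((Nat.succ 5 : ℕ) : ℝ) / ((Nat.factorial 5 : ℕ) * (5 : ℕ)) = 1 / 100 := by
      simp only [Nat.factorial]; push_cast; norm_num
    rw [e1, e3] at h1
    rw [e2, e3] at h2
    rw [abs_le] at h1 h2
    rw [Real.sinh_eq, Real.cosh_eq]
    obtain ⟨h1a, h1b⟩ := h1
    obtain ⟨h2a, h2b⟩ := h2
    refine ⟨?_, ?_, ?_, ?_⟩ <;> linarith
  have hcos : Real.cos (2 * y) = 1 - 2 * Real.sin y ^ 2 := by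
    rw [Real.cos_two_mul]; nlinarith [Real.sin_sq_add_cos_sq y]
  rw [hx2, Real.sinh_two_mul, Real.cosh_two_mul, hcos]
  -- lower bound on `sin y`
  have hp0 : 0 ≤ y - y ^ 3 / 6 := by nlinarith
  have hsin : y - y ^ 3 / 6 ≤ Real.sin y := Real.sin_ge_sub_cube hy0.le
  have hsin2 : (y - y ^ 3 / 6) ^ 2 ≤ Real.sin y ^ 2 := pow_le_pow_left₀ hp0 hsin 2
  have hsh0 : 0 ≤ Real.sinh y := Real.sinh_nonneg_iff.2 hy0.le
  have hch0 : 0 ≤ Real.cosh y := (Real.cosh_pos y).le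
  have hSm0 : 0 ≤ y + y ^ 3 / 6 - y ^ 5 / 100 := by nlinarith
  have hCm0 : 0 ≤ 1 + y ^ 2 / 2 + y ^ 4 / 24 - y ^ 5 / 100 := by nlinarith
  -- upper bound of the left side, lower bound of the right side
  have hL : (1 - 2 * Real.sin y ^ 2 + (Real.cosh y ^ 2 + Real.sinh y ^ 2)) * (2 * y) ≤
      (1 - 2 * (y - y ^ 3 / 6) ^ 2 + ((1 + y ^ 2 / 2 + y ^ 4 / 24 + y ^ 5 / 100) ^ 2 +
        (y + y ^ 3 / 6 + y ^ 5 / 100) ^ 2)) * (2 * y) := by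
    apply mul_le_mul_of_nonneg_right _ (by linarith)
    have hc2 : Real.cosh y ^ 2 ≤ (1 + y ^ 2 / 2 + y ^ 4 / 24 + y ^ 5 / 100) ^ 2 := pow_le_pow_left₀ hch0 hC2 2
    have hs2 : Real.sinh y ^ 2 ≤ (y + y ^ 3 / 6 + y ^ 5 / 100) ^ 2 := pow_le_pow_left₀ hsh0 hS2 2
    linarith
  have hR : 4 * ((y + y ^ 3 / 6 - y ^ 5 / 100) * (1 + y ^ 2 / 2 + y ^ 4 / 24 - y ^ 5 / 100)) ≤
      2 * (2 * Real.sinh y * Real.cosh y) := by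
    have := mul_le_mul hS1 hC1 hCm0 hsh0
    linarith
  -- the polynomial inequality in between: `= y³ · Q(y)` with `Q ≥ 1.23` on `[0, 0.7854]`
  have h2 : y ^ 2 ≤ 0.7854 ^ 2 := pow_le_pow_left₀ hy0.le hyb 2
  have h3 : y ^ 3 ≤ 0.7854 ^ 3 := pow_le_pow_left₀ hy0.le hyb 3
  have h4 : y ^ 4 ≤ 0.7854 ^ 4 := pow_le_pow_left₀ hy0.le hyb 4
  have h5 : y ^ 5 ≤ 0.7854 ^ 5 := pow_le_pow_left₀ hy0.le hyb 5
  have h6 : y ^ 6 ≤ 0.7854 ^ 6 := pow_le_pow_left₀ hy0.le hyb 6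
  have h7 : y ^ 7 ≤ 0.7854 ^ 7 := pow_le_pow_left₀ hy0.le hyb 7
  have h8 : y ^ 8 ≤ 0.7854 ^ 8 := pow_le_pow_left₀ hy0.le hyb 8
  have hQ : 0 ≤ 8 / 3 - 331 / 150 * y ^ 2 - 2 / 25 * y ^ 3 - 3 / 50 * y ^ 4 - 2 / 75 * y ^ 5 -
      17 / 1440 * y ^ 6 - 19 / 15000 * y ^ 7 - 1 / 2500 * y ^ 8 := by
    norm_num at h2 h3 h4 h5 h6 h7 h8
    linarith
  have hexp : 4 * ((y + y ^ 3 / 6 - y ^ 5 / 100) * (1 + y ^ 2 / 2 + y ^ 4 / 24 - y ^ 5 / 100)) -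
      (1 - 2 * (y - y ^ 3 / 6) ^ 2 + ((1 + y ^ 2 / 2 + y ^ 4 / 24 + y ^ 5 / 100) ^ 2 +
        (y + y ^ 3 / 6 + y ^ 5 / 100) ^ 2)) * (2 * y) =
      y ^ 3 * (8 / 3 - 331 / 150 * y ^ 2 - 2 / 25 * y ^ 3 - 3 / 50 * y ^ 4 - 2 / 75 * y ^ 5 -
      17 / 1440 * y ^ 6 - 19 / 15000 * y ^ 7 - 1 / 2500 * y ^ 8) := by ring
  have hy3 : 0 ≤ y ^ 3 := by positivity
  have hmid := mul_nonneg hy3 hQ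
  rw [← hexp] at hmid
  linarith

/-- **No class is unstable on an unwrapped line in both slots:** `σ(k, β) = 0` whenever `0 < k ≤ β ≤ ½`
(`cos πβ ≤ cos πk ≤ D(πk)`). [cite: Drazin2002, §8.3 (8.36)–(8.38) and Exercise 8.10] -/
theorem sawSigma_eq_zero_of_le {k β : ℝ} (hk : 0 < k) (hkβ : k ≤ β) (hβ : β ≤ 1 / 2) :
    sawSigma k β = 0 := by
  apply sawSigma_eq_zero_of_cos_sq_le hk
  have hx0 : 0 < π * k := by positivity
  have hx1 : π * k ≤ π / 2 := by
    have : k ≤ 1 / 2 := hkβ.trans hβ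
    nlinarith [Real.pi_pos]
  have hD := cos_le_khD hx0 hx1
  have hcos : Real.cos (π * β) ≤ Real.cos (π * k) := by
    apply Real.cos_le_cos_of_nonneg_of_le_pi hx0.le
    · nlinarith [Real.pi_pos]
    · exact mul_le_mul_of_nonneg_left hkβ Real.pi_pos.le
  have hcos0 : 0 ≤ Real.cos (π * β) := by
    apply Real.cos_nonneg_of_neg_pi_div_two_le_of_le
    · nlinarith [Real.pi_pos, hk.le.trans hkβ]
    · nlinarith [Real.pi_pos]
  have h1 : Real.cos (π * β) ≤ 2 * Real.sinh (π * k) / (π * k) - Real.cosh (π * k) := hcos.trans hD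
  exact pow_le_pow_left₀ hcos0 h1 2

end Summit.AnomalousDissipation.AnomalousDissipation.Theorems.SawtoothPulseCascade.K2PhaseBudget

end
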